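import Literature.AlgebraicGeometry.Morphisms.CechH1
import Mathlib.AlgebraicGeometry.Modules.Sheaf
import HarnessLib

/-!
# Čech cochains and `Ȟ⁰`, `Ȟ¹` of a sheaf of `𝒪_X`-modules on a family of opens

`Morphisms/CechH1` builds, for a scheme `f : X → Spec A` over a ring `A` and a family of opens
`U : ι → X.Opens`, the (full, ordered) Čech complex of the STRUCTURE SHEAF in degrees `≤ 2` and
`Ȟ¹(𝒰, 𝒪_X)` as `A`-modules. This file does the same for an arbitrary sheaf of `𝒪_X`-modules
`M : X.Modules` (Mathlib's `SheafOfModules` over `X.ringCatSheaf`): the Čech complex of a sheaf of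
modules with respect to a family of opens (The Stacks Project, Tag 01ED = Cohomology, Section 20.9, all
ordered tuples, Tag 01EF; Görtz–Wedhorn II, (21.14) Def. 21.64) in degrees `0, 1, 2`,

* `MSections f M V` — `Γ(V, M)` as an `A`-module through `A → Γ(X, 𝒪_X) → Γ(V, 𝒪_X)`, with the
  `A`-linear restriction maps `MSections.res` and the `A`-linear action `MSections.app φ` of a morphism
  `φ : M → N` of `𝒪_X`-modules;
* `CechMC0/1/2`, `cechMD0`, `cechMD1` (`d¹ ∘ d⁰ = 0`), cocycles `cechMZ1`, coboundaries `cechMB1`,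
  **`CechMH1 f M U = Ȟ¹(𝒰, M)`** and **`cechMH0 f M U = Ȟ⁰(𝒰, M) = Ker d⁰`**, all `A`-modules;
* functoriality in `M`: `cechMapC0/C1/C2`, commuting with the differentials, `cechMapH0`, `cechMapH1`
  (Tag 01ED: "the Čech complex is functorial in the sheaf");

the degree-`≤ 1` Čech cohomology of quasi-coherent modules being the carrier of the finiteness
statements for coherent sheaves on proper schemes (Görtz–Wedhorn II, Thm. 22.9 and Cor. 23.18; The
Stacks Project, Tags 01XD, 02O5) towards the named fact
`Literature.AlgebraicGeometry.Morphisms.cechH1_finite`. Exactness properties (the long exact sequence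
in degrees `≤ 1`) and the comparison with `CechH1 f U` for `M = 𝒪_X` are in sibling files.
Everything is proved; no named facts. Mathlib searched (pin v4.32): `AlgebraicGeometry.Scheme.Modules`
with `Γ(M, U)`, `Scheme.Modules.map_smul`, `Scheme.Modules.Hom.app`, `Hom.app_smul`, `Hom.comp_app`
(used); `CategoryTheory/Sites/SheafCohomology/Cech` has the full Čech complex of a presheaf on a site as
an abstract cochain complex but no `A`-module structure, no low-degree API and no link with
`X.Modules`.

## References

* The Stacks Project, Tags 01ED, 01EF (Cohomology, Section 20.9: the Čech complex of a presheaf of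
  modules and its functoriality). [StacksProject]
* U. Görtz, T. Wedhorn, *Algebraic Geometry II: Cohomology of Schemes*, Springer Spektrum (2023),
  doi:10.1007/978-3-658-43031-3: (21.14) Def. 21.64, p. 258; Thm. 22.9, p. 332. [GortzWedhorn2023]
-/

noncomputable section

open CategoryTheory AlgebraicGeometry Limits TopologicalSpace Opposite

universe u v

namespace Literature.AlgebraicGeometry.Morphisms

variable {A : Type u} [CommRing A] {X : Scheme.{u}} (f : X ⟶ Spec (.of A)) (M : X.Modules)

/-- The sections `Γ(V, M)` of a sheaf of `𝒪_X`-modules over an open `V` of an `A`-scheme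
`f : X → Spec A` (a type synonym of Mathlib's `Γ(M, V)`, to carry the `A`-module structure through
`A → Γ(X, 𝒪_X) → Γ(V, 𝒪_X)`, which depends on `f`). [folklore] -/
def MSections (_f : X ⟶ Spec (.of A)) (M : X.Modules) (V : X.Opens) : Type u := Γ(M, V)

namespace MSections

section Res

variable (V : X.Opens)

/-- The additive group structure of `Γ(V, M)`. [folklore] -/
instance : AddCommGroup (MSections f M V) := inferInstanceAs (AddCommGroup Γ(M, V))

/-- The `Γ(V, 𝒪_X)`-module structure of `Γ(V, M)` (`Sections f V = Γ(V, 𝒪_X)`). [folklore] -/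
instance instModuleSections : Module (Sections f V) (MSections f M V) :=
  inferInstanceAs (Module Γ(X, V) Γ(M, V))

/-- The `A`-module structure of `Γ(V, M)` through `A → Γ(V, 𝒪_X)`. [folklore] -/
instance : Module A (MSections f M V) := Module.compHom _ (algebraMap A (Sections f V))

/-- `A` acts through `Γ(V, 𝒪_X)`. [folklore] -/
instance : IsScalarTower A (Sections f V) (MSections f M V) :=
  ⟨fun a s m => by
    change (a • s) • m = algebraMap A (Sections f V) a • s • m
    rw [Algebra.smul_def, mul_smul]⟩

/-- Unfolding of the `A`-action on `Γ(V, M)`. [folklore] -/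
theorem algebraMap_smul (a : A) (m : MSections f M V) :
    algebraMap A (Sections f V) a • m = a • m := rfl

variable {V}

/-- Restriction of sections of `M` to a smaller open, an `A`-linear map. [folklore] -/
def res {W : X.Opens} (h : W ≤ V) : MSections f M V →ₗ[A] MSections f M W where
  toFun m := M.presheaf.map (homOfLE h).op m
  map_add' m m' := map_add _ m m'
  map_smul' a m := by
    have h1 := Scheme.Modules.map_smul M (homOfLE h) (algebraMap A (Sections f V) a) m
    have h2 : X.presheaf.map (homOfLE h).op (algebraMap A (Sections f V) a) =
        algebraMap A (Sections f W) a := (Sections.res f h).commutes a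
    rw [h2] at h1
    exact h1

/-- `res` is the restriction map of the sheaf `M`. [folklore] -/
theorem res_apply {W : X.Opens} (h : W ≤ V) (m : MSections f M V) :
    res f M h m = M.presheaf.map (homOfLE h).op m := rfl

/-- Restriction is semilinear over the restriction of functions. [folklore] -/
theorem res_smul {W : X.Opens} (h : W ≤ V) (s : Sections f V) (m : MSections f M V) :
    res f M h (s • m) = Sections.res f h s • res f M h m :=
  Scheme.Modules.map_smul M (homOfLE h) s m

/-- Restriction to the same open is the identity. [folklore] -/
@[simp]
theorem res_self (m : MSections f M V) : res f M (le_refl V) m = m := by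
  have : (homOfLE (le_refl V)).op = 𝟙 (op V) := Subsingleton.elim _ _
  rw [res_apply, this, M.presheaf.map_id]
  rfl

/-- Restriction is transitive. [folklore] -/
@[simp]
theorem res_res {W W' : X.Opens} (h : W ≤ V) (h' : W' ≤ W) (m : MSections f M V) :
    res f M h' (res f M h m) = res f M (h'.trans h) m := by
  change (M.presheaf.map (homOfLE h).op ≫ M.presheaf.map (homOfLE h').op) m = _
  rw [← Functor.map_comp]
  rfl

/-- Proof-irrelevance of the inequality in `res`. [folklore] -/
theorem res_eq_res {W : X.Opens} (h h' : W ≤ V) (m : MSections f M V) :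
    res f M h m = res f M h' m := rfl

end Res

section App

variable {M} {N P : X.Modules} (φ : M ⟶ N) (ψ : N ⟶ P) (V : X.Opens)

/-- The action `Γ(V, M) → Γ(V, N)` of a morphism of `𝒪_X`-modules on sections, `A`-linear.
[folklore] -/
def app : MSections f M V →ₗ[A] MSections f N V where
  toFun m := φ.app V m
  map_add' m m' := map_add (φ.app V).hom m m'
  map_smul' a m := Scheme.Modules.Hom.app_smul φ (algebraMap A (Sections f V) a) m

/-- Unfolding of `app`. [folklore] -/
theorem app_apply (m : MSections f M V) : app f φ V m = φ.app V m := rfl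

/-- `app` is `Γ(V, 𝒪_X)`-linear. [folklore] -/
theorem app_smul (s : Sections f V) (m : MSections f M V) : app f φ V (s • m) = s • app f φ V m :=
  Scheme.Modules.Hom.app_smul φ s m

variable {V} in
/-- Morphisms of sheaves commute with restriction. [folklore] -/
theorem res_app {W : X.Opens} (h : W ≤ V) (m : MSections f M V) :
    res f N h (app f φ V m) = app f φ W (res f M h m) :=
  (ConcreteCategory.congr_hom (φ.mapPresheaf.naturality (homOfLE h).op) m).symm

/-- `app` of the identity. [folklore] -/
@[simp]
theorem app_id (m : MSections f M V) : app f (𝟙 M) V m = m := rfl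

/-- `app` of a composite. [folklore] -/
theorem app_comp (m : MSections f M V) : app f (φ ≫ ψ) V m = app f ψ V (app f φ V m) := rfl

/-- `app` of the zero morphism. [folklore] -/
@[simp]
theorem app_zero (m : MSections f M V) : app f (0 : M ⟶ N) V m = 0 := rfl

end App

end MSections

/-! ## The Čech complex of `M` in degrees `≤ 2` -/

section Cech

variable {ι : Type v} (U : ι → X.Opens)

/-- Čech `0`-cochains `Č⁰(𝒰, M) = Π_i Γ(U_i, M)`. [cite: StacksProject, Tag 01ED (Cohomology, Section 20.9)] -/
abbrev CechMC0 : Type (max u v) := (i : ι) → MSections f M (U i)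

/-- Čech `1`-cochains `Č¹(𝒰, M) = Π_{i,j} Γ(U_i ∩ U_j, M)` (all ordered pairs).
[cite: StacksProject, Tag 01ED (Cohomology, Section 20.9)] -/
abbrev CechMC1 : Type (max u v) := (i j : ι) → MSections f M (U i ⊓ U j)

/-- Čech `2`-cochains `Č²(𝒰, M) = Π_{i,j,k} Γ(U_i ∩ U_j ∩ U_k, M)` (all ordered triples).
[cite: StacksProject, Tag 01ED (Cohomology, Section 20.9)] -/
abbrev CechMC2 : Type (max u v) := (i j k : ι) → MSections f M (U i ⊓ U j ⊓ U k)

/-- The Čech differential `d⁰ : Č⁰ → Č¹`, `(d⁰ b)_{ij} = b_j| - b_i|`.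
[cite: StacksProject, Tag 01ED (Cohomology, Section 20.9)] -/
def cechMD0 : CechMC0 f M U →ₗ[A] CechMC1 f M U where
  toFun b i j := MSections.res f M inf_le_right (b j) - MSections.res f M inf_le_left (b i)
  map_add' b b' := by ext i j; simp only [Pi.add_apply, map_add]; abel
  map_smul' a b := by ext i j; simp only [Pi.smul_apply, map_smul, RingHom.id_apply, smul_sub]

/-- The Čech differential `d¹ : Č¹ → Č²`, `(d¹ c)_{ijk} = c_{jk}| - c_{ik}| + c_{ij}|`.
[cite: StacksProject, Tag 01ED (Cohomology, Section 20.9)] -/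
def cechMD1 : CechMC1 f M U →ₗ[A] CechMC2 f M U where
  toFun c i j k :=
    MSections.res f M (le_inf (inf_le_left.trans inf_le_right) inf_le_right) (c j k) -
      MSections.res f M (le_inf (inf_le_left.trans inf_le_left) inf_le_right) (c i k) +
        MSections.res f M inf_le_left (c i j)
  map_add' c c' := by ext i j k; simp only [Pi.add_apply, map_add]; abel
  map_smul' a c := by
    ext i j k; simp only [Pi.smul_apply, map_smul, RingHom.id_apply, smul_sub, smul_add]

/-- Unfolding of `cechMD0`. [folklore] -/
theorem cechMD0_apply (b : CechMC0 f M U) (i j : ι) :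
    cechMD0 f M U b i j = MSections.res f M inf_le_right (b j) - MSections.res f M inf_le_left (b i) :=
  rfl

/-- Unfolding of `cechMD1`. [folklore] -/
theorem cechMD1_apply (c : CechMC1 f M U) (i j k : ι) :
    cechMD1 f M U c i j k =
      MSections.res f M (le_inf (inf_le_left.trans inf_le_right) inf_le_right) (c j k) -
        MSections.res f M (le_inf (inf_le_left.trans inf_le_left) inf_le_right) (c i k) +
          MSections.res f M inf_le_left (c i j) :=
  rfl

/-- `d¹ ∘ d⁰ = 0`. [cite: StacksProject, Tag 01ED (Cohomology, Section 20.9)] -/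
theorem cechMD1_cechMD0 (b : CechMC0 f M U) : cechMD1 f M U (cechMD0 f M U b) = 0 := by
  ext i j k
  simp only [cechMD1_apply, cechMD0_apply, map_sub, MSections.res_res, Pi.zero_apply]
  rw [MSections.res_eq_res f M _ ((inf_le_left.trans inf_le_left : U i ⊓ U j ⊓ U k ≤ U i)) (b i),
    MSections.res_eq_res f M _ ((inf_le_left.trans inf_le_right : U i ⊓ U j ⊓ U k ≤ U j)) (b j),
    MSections.res_eq_res f M _ ((inf_le_right : U i ⊓ U j ⊓ U k ≤ U k)) (b k)]
  abel

/-- Čech `1`-cocycles `Ž¹(𝒰, M) = ker d¹`. [cite: StacksProject, Tag 01ED (Cohomology, Section 20.9)] -/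
def cechMZ1 : Submodule A (CechMC1 f M U) := LinearMap.ker (cechMD1 f M U)

/-- Čech `1`-coboundaries `B̌¹(𝒰, M) = im d⁰`. [cite: StacksProject, Tag 01ED (Cohomology, Section 20.9)] -/
def cechMB1 : Submodule A (CechMC1 f M U) := LinearMap.range (cechMD0 f M U)

/-- Membership in `Ž¹`. [folklore] -/
theorem mem_cechMZ1_iff (c : CechMC1 f M U) : c ∈ cechMZ1 f M U ↔ cechMD1 f M U c = 0 :=
  LinearMap.mem_ker

/-- Membership in `B̌¹`. [folklore] -/
theorem mem_cechMB1_iff (c : CechMC1 f M U) : c ∈ cechMB1 f M U ↔ ∃ b, cechMD0 f M U b = c :=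
  LinearMap.mem_range

/-- `B̌¹ ⊆ Ž¹`. [folklore] -/
theorem cechMB1_le_cechMZ1 : cechMB1 f M U ≤ cechMZ1 f M U := by
  rintro c ⟨b, rfl⟩
  exact cechMD1_cechMD0 f M U b

/-- **`Ȟ¹(𝒰, M) = Ž¹ / B̌¹`**, the first Čech cohomology of the sheaf of modules `M` with respect to
the family of opens `U`, an `A`-module.
[cite: StacksProject, Tag 01ED (Cohomology, Section 20.9)] -/
abbrev CechMH1 : Type (max u v) :=
  ↥(cechMZ1 f M U) ⧸ (cechMB1 f M U).comap (cechMZ1 f M U).subtype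

/-- The class of a `1`-cocycle in `Ȟ¹(𝒰, M)`. [folklore] -/
def CechMH1.mk : ↥(cechMZ1 f M U) →ₗ[A] CechMH1 f M U := Submodule.mkQ _

/-- `CechMH1.mk` is surjective. [folklore] -/
theorem CechMH1.mk_surjective : Function.Surjective (CechMH1.mk f M U) := Submodule.mkQ_surjective _

/-- A cocycle has class `0` iff it is a coboundary. [folklore] -/
theorem CechMH1.mk_eq_zero_iff (z : cechMZ1 f M U) :
    CechMH1.mk f M U z = 0 ↔ (z : CechMC1 f M U) ∈ cechMB1 f M U := by
  rw [CechMH1.mk, Submodule.mkQ_apply, Submodule.Quotient.mk_eq_zero, Submodule.mem_comap]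
  rfl

/-- Two cocycles have the same class iff they differ by a coboundary. [folklore] -/
theorem CechMH1.mk_eq_mk_iff (z z' : cechMZ1 f M U) :
    CechMH1.mk f M U z = CechMH1.mk f M U z' ↔ (z : CechMC1 f M U) - z' ∈ cechMB1 f M U := by
  rw [CechMH1.mk, Submodule.mkQ_apply, Submodule.mkQ_apply, Submodule.Quotient.eq,
    Submodule.mem_comap]
  rfl

/-- **`Ȟ⁰(𝒰, M) = Ker d⁰`**: the families of sections `b_i ∈ Γ(U_i, M)` agreeing on the overlaps
(for `𝒰` a covering this is `Γ(X, M)` by the sheaf axiom).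
[cite: StacksProject, Tag 01ED (Cohomology, Section 20.9)] -/
def cechMH0 : Submodule A (CechMC0 f M U) := LinearMap.ker (cechMD0 f M U)

/-- Membership in `Ȟ⁰`. [folklore] -/
theorem mem_cechMH0_iff (b : CechMC0 f M U) :
    b ∈ cechMH0 f M U ↔ ∀ i j, MSections.res f M (inf_le_right : U i ⊓ U j ≤ U j) (b j) =
      MSections.res f M (inf_le_left : U i ⊓ U j ≤ U i) (b i) := by
  rw [cechMH0, LinearMap.mem_ker]
  constructor
  · intro h i j
    exact sub_eq_zero.mp (congrFun (congrFun h i) j)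
  · intro h
    funext i j
    exact sub_eq_zero.mpr (h i j)

end Cech

/-! ## Functoriality in the sheaf of modules -/

section Map

variable {M} {N P : X.Modules} (φ : M ⟶ N) (ψ : N ⟶ P) {ι : Type v} (U : ι → X.Opens)

/-- `φ` on `0`-cochains. [cite: StacksProject, Tag 01ED (Cohomology, Section 20.9)] -/
def cechMapC0 : CechMC0 f M U →ₗ[A] CechMC0 f N U :=
  LinearMap.pi fun i => MSections.app f φ (U i) ∘ₗ LinearMap.proj i

/-- `φ` on `1`-cochains. [cite: StacksProject, Tag 01ED (Cohomology, Section 20.9)] -/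
def cechMapC1 : CechMC1 f M U →ₗ[A] CechMC1 f N U :=
  LinearMap.pi fun i => LinearMap.pi fun j =>
    MSections.app f φ (U i ⊓ U j) ∘ₗ LinearMap.proj j ∘ₗ LinearMap.proj (R := A)
      (φ := fun i => ∀ j, MSections f M (U i ⊓ U j)) i

/-- `φ` on `2`-cochains. [cite: StacksProject, Tag 01ED (Cohomology, Section 20.9)] -/
def cechMapC2 : CechMC2 f M U →ₗ[A] CechMC2 f N U :=
  LinearMap.pi fun i => LinearMap.pi fun j => LinearMap.pi fun k =>
    MSections.app f φ (U i ⊓ U j ⊓ U k) ∘ₗ LinearMap.proj k ∘ₗ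
      LinearMap.proj (R := A) (φ := fun j => ∀ k, MSections f M (U i ⊓ U j ⊓ U k)) j ∘ₗ
        LinearMap.proj (R := A) (φ := fun i => ∀ j k, MSections f M (U i ⊓ U j ⊓ U k)) i

/-- Unfolding of `cechMapC0`. [folklore] -/
@[simp]
theorem cechMapC0_apply (b : CechMC0 f M U) (i : ι) :
    cechMapC0 f φ U b i = MSections.app f φ _ (b i) := rfl

/-- Unfolding of `cechMapC1`. [folklore] -/
@[simp]
theorem cechMapC1_apply (c : CechMC1 f M U) (i j : ι) :
    cechMapC1 f φ U c i j = MSections.app f φ _ (c i j) := rfl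

/-- Unfolding of `cechMapC2`. [folklore] -/
@[simp]
theorem cechMapC2_apply (c : CechMC2 f M U) (i j k : ι) :
    cechMapC2 f φ U c i j k = MSections.app f φ _ (c i j k) := rfl

/-- `φ` commutes with `d⁰`. [cite: StacksProject, Tag 01ED (Cohomology, Section 20.9)] -/
theorem cechMD0_mapC0 (b : CechMC0 f M U) :
    cechMD0 f N U (cechMapC0 f φ U b) = cechMapC1 f φ U (cechMD0 f M U b) := by
  funext i j
  simp only [cechMD0_apply, cechMapC0_apply, cechMapC1_apply, map_sub, MSections.res_app]

/-- `φ` commutes with `d¹`. [cite: StacksProject, Tag 01ED (Cohomology, Section 20.9)] -/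
theorem cechMD1_mapC1 (c : CechMC1 f M U) :
    cechMD1 f N U (cechMapC1 f φ U c) = cechMapC2 f φ U (cechMD1 f M U c) := by
  funext i j k
  simp only [cechMD1_apply, cechMapC1_apply, cechMapC2_apply, map_sub, map_add, MSections.res_app]

/-- `φ` maps cocycles to cocycles. [folklore] -/
theorem mapC1_mem_cechMZ1 {c : CechMC1 f M U} (hc : c ∈ cechMZ1 f M U) :
    cechMapC1 f φ U c ∈ cechMZ1 f N U := by
  rw [mem_cechMZ1_iff] at hc ⊢
  rw [cechMD1_mapC1, hc, map_zero]

/-- `φ` maps coboundaries to coboundaries. [folklore] -/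
theorem mapC1_mem_cechMB1 {c : CechMC1 f M U} (hc : c ∈ cechMB1 f M U) :
    cechMapC1 f φ U c ∈ cechMB1 f N U := by
  rw [mem_cechMB1_iff] at hc ⊢
  obtain ⟨b, rfl⟩ := hc
  exact ⟨cechMapC0 f φ U b, cechMD0_mapC0 f φ U b⟩

/-- `φ` on `Ȟ⁰`: cocycles go to cocycles. [folklore] -/
theorem mapC0_mem_cechMH0 {b : CechMC0 f M U} (hb : b ∈ cechMH0 f M U) :
    cechMapC0 f φ U b ∈ cechMH0 f N U := by
  rw [cechMH0, LinearMap.mem_ker] at hb ⊢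
  rw [cechMD0_mapC0, hb, map_zero]

/-- **`Ȟ⁰(𝒰, φ) : Ȟ⁰(𝒰, M) → Ȟ⁰(𝒰, N)`.** [cite: StacksProject, Tag 01ED (Cohomology, Section 20.9)] -/
def cechMapH0 : ↥(cechMH0 f M U) →ₗ[A] ↥(cechMH0 f N U) :=
  (cechMapC0 f φ U).restrict fun _ hb => mapC0_mem_cechMH0 f φ U hb

/-- Unfolding of `cechMapH0`. [folklore] -/
@[simp]
theorem cechMapH0_coe (b : cechMH0 f M U) :
    (cechMapH0 f φ U b : CechMC0 f N U) = cechMapC0 f φ U b := rfl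

/-- `φ` on cocycles. [folklore] -/
def cechMapZ1 : ↥(cechMZ1 f M U) →ₗ[A] ↥(cechMZ1 f N U) :=
  (cechMapC1 f φ U).restrict fun _ hc => mapC1_mem_cechMZ1 f φ U hc

/-- Unfolding of `cechMapZ1`. [folklore] -/
@[simp]
theorem cechMapZ1_coe (z : cechMZ1 f M U) :
    (cechMapZ1 f φ U z : CechMC1 f N U) = cechMapC1 f φ U z := rfl

/-- **`Ȟ¹(𝒰, φ) : Ȟ¹(𝒰, M) → Ȟ¹(𝒰, N)`.** [cite: StacksProject, Tag 01ED (Cohomology, Section 20.9)] -/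
def cechMapH1 : CechMH1 f M U →ₗ[A] CechMH1 f N U :=
  Submodule.mapQ _ _ (cechMapZ1 f φ U) fun z hz => by
    rw [Submodule.mem_comap] at hz ⊢
    exact mapC1_mem_cechMB1 f φ U hz

/-- `Ȟ¹(φ)[z] = [φ z]`. [folklore] -/
@[simp]
theorem cechMapH1_mk (z : cechMZ1 f M U) :
    cechMapH1 f φ U (CechMH1.mk f M U z) = CechMH1.mk f N U (cechMapZ1 f φ U z) := rfl

/-- `Ȟ¹` of a composite. [folklore] -/
theorem cechMapH1_comp (x : CechMH1 f M U) :
    cechMapH1 f (φ ≫ ψ) U x = cechMapH1 f ψ U (cechMapH1 f φ U x) := by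
  obtain ⟨z, rfl⟩ := CechMH1.mk_surjective f M U x
  rfl

/-- `Ȟ¹` of the zero morphism. [folklore] -/
theorem cechMapH1_zero (x : CechMH1 f M U) : cechMapH1 f (0 : M ⟶ N) U x = 0 := by
  obtain ⟨z, rfl⟩ := CechMH1.mk_surjective f M U x
  rw [cechMapH1_mk, ← map_zero (CechMH1.mk f N U)]
  congr 1

end Map

end Literature.AlgebraicGeometry.Morphisms

end
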